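import Literature.Probability.RandomPlanarGeometry.HexSAWBrickWallStripFugacityWidthOneContactSusceptibility
import HarnessLib

/-!
# The susceptibilities of the uniform strip in closed form (plastic number)

Child module of `…ContactSusceptibility` (the density map `(log y, log z) ↦ (b, b')` is `C¹` with derivative `M⁻¹`).  At the UNIFORM point
`y = z = 1` everything is explicit in the connective constant `μ = μ(S₁)` (the plastic number, `μ³ = μ + 1`, `b(1,1) = (μ+1)/(2(2μ+3))`):
* §1 the entropy Hessian at the typical pair: `m₁₁ = m₂₂ = 28μ² + 10μ − 2`, `m₁₂ = 24μ² + 8μ + 4`, `det = 164 + 280μ − 60μ²`;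
* §2 ★★★ **THE SUSCEPTIBILITIES OF THE UNIFORM STRIP**: `∂b/∂log y |_{(1,1)} = (21μ² + 95μ − 14)/1058 ∈ (0.1405, 0.1406)` and the cross
  response `∂b/∂log z |_{(1,1)} = (16 − 33μ − 24μ²)/529 ∈ (−0.1321, −0.1320)` (`1058 = 2·23²`): switching on a weak attraction at the
  bottom wall raises the bottom contact density at rate `0.1405…` per unit of `log y` and LOWERS the top one at rate `0.1320…`.

## Sources
DemboZeitouni2010 §2.2 (lane statement); BeatonBousquetMelouDeGierDuminilCopinGuttmann2014 §3.2 Proposition 6 (arXiv v5 p. 10: the strip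
`S_1`).  Nothing quoted AS PRINTED; the closed forms are this lineage's (algebra in `ℚ(μ)`, `μ³ = μ + 1`).
-/

noncomputable section

open Filter Topology Finset Literature.Probability.LatticeModels Literature.Probability.Percolation SimpleGraph

namespace Literature.Probability.RandomPlanarGeometry.SAW.HexBW

open WidthOneYZ Real

/-! ## §1 The entropy Hessian at the uniform typical pair -/

/-- `b(1,1) = (μ+1)/(2(2μ+3))` (the tree's `contactB_one_one` and `stripOneSpeed`). [cite: BeatonBousquetMelouDeGierDuminilCopinGuttmann2014, §3.2 Proposition 6 (arXiv v5 p. 10; lane plumbing)] -/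
theorem contactB_one_one_eq_plastic :
    contactB 1 1 = (stripConnectiveConstant 1 + 1) / (2 * (2 * stripConnectiveConstant 1 + 3)) := by
  rw [contactB_one_one]
  unfold stripOneSpeed
  have h : (2 : ℝ) * stripConnectiveConstant 1 + 3 ≠ 0 := by
    have := stripConnectiveConstant_one_mem_Ioo.1; positivity
  field_simp
  ring

/-- ★ **The entropy Hessian at the uniform point**: with `β = b(1,1)` and `μ = μ(S₁)`,
`4/(1−4β) + 10/(6β−1) − 1/β = 28μ² + 10μ − 2` (`= m₁₁ = m₂₂`), `4/(1−4β) + 8/(6β−1) = 24μ² + 8μ + 4` (`= m₁₂`), and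
`m₁₁² − m₁₂² = 164 + 280μ − 60μ² > 0`. [cite: DemboZeitouni2010, §2.2 (lane statement)] -/
theorem entropyHessian_uniform :
    let μ := stripConnectiveConstant 1
    let β := contactB 1 1
    4 / (1 - 2 * β - 2 * β) + 8 / (4 * β + 2 * β - 1) + 2 / (2 * β + 4 * β - 1) - 1 / β = 28 * μ ^ 2 + 10 * μ - 2 ∧
    4 / (1 - 2 * β - 2 * β) + 4 / (4 * β + 2 * β - 1) + 4 / (2 * β + 4 * β - 1) = 24 * μ ^ 2 + 8 * μ + 4 ∧
    (28 * μ ^ 2 + 10 * μ - 2) * (28 * μ ^ 2 + 10 * μ - 2) - (24 * μ ^ 2 + 8 * μ + 4) ^ 2 = 164 + 280 * μ - 60 * μ ^ 2 ∧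
    0 < 164 + 280 * μ - 60 * μ ^ 2 := by
  intro μ β
  have hμ1 : (1.3247 : ℝ) < μ := stripConnectiveConstant_one_mem_Ioo.1
  have hμ2 : μ < (1.3248 : ℝ) := stripConnectiveConstant_one_mem_Ioo.2
  have hc : μ ^ 3 = μ + 1 := stripConnectiveConstant_one_pow_three
  have hc0 : μ ^ 3 - μ - 1 = 0 := by rw [hc]; ring
  have hβ : β = (μ + 1) / (2 * (2 * μ + 3)) := contactB_one_one_eq_plastic
  have h23 : (2 : ℝ) * μ + 3 ≠ 0 := by positivity
  have hμ0 : μ ≠ 0 := by positivity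
  have hμ1' : μ + 1 ≠ 0 := by positivity
  -- the three denominators in terms of `μ`
  have d1 : 1 - 2 * β - 2 * β = 1 / (2 * μ + 3) := by rw [hβ]; field_simp; ring
  have d2 : 4 * β + 2 * β - 1 = μ / (2 * μ + 3) := by rw [hβ]; field_simp; ring
  have d3 : 2 * β + 4 * β - 1 = μ / (2 * μ + 3) := by rw [hβ]; field_simp; ring
  refine ⟨?_, ?_, ?_, ?_⟩
  · rw [d1, d2, d3, hβ]
    have key : 4 / (1 / (2 * μ + 3)) + 8 / (μ / (2 * μ + 3)) + 2 / (μ / (2 * μ + 3)) - 1 / ((μ + 1) / (2 * (2 * μ + 3)))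
        - (28 * μ ^ 2 + 10 * μ - 2) = (-28 * μ - 30) * (μ ^ 3 - μ - 1) / (μ * (μ + 1)) := by
      field_simp; ring
    rw [hc0, mul_zero, zero_div, sub_eq_zero] at key
    exact key
  · rw [d1, d2, d3]
    have key : 4 / (1 / (2 * μ + 3)) + 4 / (μ / (2 * μ + 3)) + 4 / (μ / (2 * μ + 3)) - (24 * μ ^ 2 + 8 * μ + 4) =
        (-24) * (μ ^ 3 - μ - 1) / μ := by
      field_simp; ring
    rw [hc0, mul_zero, zero_div, sub_eq_zero] at key
    exact key
  · have key : (28 * μ ^ 2 + 10 * μ - 2) * (28 * μ ^ 2 + 10 * μ - 2) - (24 * μ ^ 2 + 8 * μ + 4) ^ 2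
        - (164 + 280 * μ - 60 * μ ^ 2) = (176 + 208 * μ) * (μ ^ 3 - μ - 1) := by ring
    rw [hc0, mul_zero, sub_eq_zero] at key
    exact key
  · nlinarith

/-! ## §2 The susceptibilities of the uniform strip -/

/-- ★★★ **THE SUSCEPTIBILITIES OF THE UNIFORM STRIP IN CLOSED FORM**: with `μ = μ(S₁)` the plastic number,
`d/dt b(e^t, 1)|_{t=0} = (21μ² + 95μ − 14)/1058` (own-wall response at the uniform point) and
`d/dt b(1, e^t)|_{t=0} = (16 − 33μ − 24μ²)/529` (cross response: the walls compete).
[cite: DemboZeitouni2010, §2.2 (lane statement); BeatonBousquetMelouDeGierDuminilCopinGuttmann2014, §3.2 Proposition 6 (arXiv v5 p. 10)] -/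
theorem susceptibility_uniform :
    HasDerivAt (fun t => contactB (Real.exp t) 1)
        ((21 * stripConnectiveConstant 1 ^ 2 + 95 * stripConnectiveConstant 1 - 14) / 1058) 0 ∧
      HasDerivAt (fun t => contactB 1 (Real.exp t))
        ((16 - 33 * stripConnectiveConstant 1 - 24 * stripConnectiveConstant 1 ^ 2) / 529) 0 := by
  set μ := stripConnectiveConstant 1 with hμ
  have h := hasDerivAt_contactB_log 0 0
  simp only [Real.exp_zero] at h
  obtain ⟨hD, -, dA1, dB1, -, -, -⟩ := h
  obtain ⟨e11, e12, eD, hDpos⟩ := entropyHessian_uniform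
  rw [← hμ] at e11 e12 eD hDpos
  have hc : μ ^ 3 = μ + 1 := by rw [hμ]; exact stripConnectiveConstant_one_pow_three
  -- by symmetry `m₂₂ = m₁₁` at the uniform point
  have e22 : 4 / (1 - 2 * contactB 1 1 - 2 * contactB 1 1) + 2 / (4 * contactB 1 1 + 2 * contactB 1 1 - 1) +
      8 / (2 * contactB 1 1 + 4 * contactB 1 1 - 1) - 1 / contactB 1 1 = 28 * μ ^ 2 + 10 * μ - 2 := by
    rw [← e11]; ring
  rw [e11, e12, e22] at dA1 dB1
  have hden : (28 * μ ^ 2 + 10 * μ - 2) * (28 * μ ^ 2 + 10 * μ - 2) - (24 * μ ^ 2 + 8 * μ + 4) ^ 2 ≠ 0 := by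
    rw [eD]; exact hDpos.ne'
  constructor
  · refine dA1.congr_deriv ?_
    rw [div_eq_div_iff hden (by norm_num)]
    linear_combination (2284 - 12548 * μ - 23456 * μ ^ 2 - 4368 * μ ^ 3) * hc
  · refine dB1.congr_deriv ?_
    rw [div_eq_div_iff hden (by norm_num)]
    linear_combination (1924 + 1040 * μ + 11088 * μ ^ 2 + 4992 * μ ^ 3) * hc

/-- ★★ **Numerically**: `0.1405 < ∂b/∂log y|_{(1,1)} < 0.1406` and `−0.1321 < ∂b/∂log z|_{(1,1)} < −0.1320` (from `1.3247 < μ < 1.3248`).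
[cite: DemboZeitouni2010, §2.2 (lane statement)] -/
theorem susceptibility_uniform_bounds :
    (0.1405 : ℝ) < (21 * stripConnectiveConstant 1 ^ 2 + 95 * stripConnectiveConstant 1 - 14) / 1058 ∧
      (21 * stripConnectiveConstant 1 ^ 2 + 95 * stripConnectiveConstant 1 - 14) / 1058 < 0.1406 ∧
      (-0.1321 : ℝ) < (16 - 33 * stripConnectiveConstant 1 - 24 * stripConnectiveConstant 1 ^ 2) / 529 ∧
      (16 - 33 * stripConnectiveConstant 1 - 24 * stripConnectiveConstant 1 ^ 2) / 529 < -0.1320 := by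
  have hμ1 : (1.3247 : ℝ) < stripConnectiveConstant 1 := stripConnectiveConstant_one_mem_Ioo.1
  have hμ2 : stripConnectiveConstant 1 < (1.3248 : ℝ) := stripConnectiveConstant_one_mem_Ioo.2
  refine ⟨?_, ?_, ?_, ?_⟩
  · rw [lt_div_iff₀ (by norm_num)]; nlinarith
  · rw [div_lt_iff₀ (by norm_num)]; nlinarith
  · rw [lt_div_iff₀ (by norm_num)]; nlinarith
  · rw [div_lt_iff₀ (by norm_num)]; nlinarith

end Literature.Probability.RandomPlanarGeometry.SAW.HexBW
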